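import Literature.AlgebraicGeometry.ComplexMultiplication.IrreducibleOddWeightsBlockAdditivity
import Literature.AlgebraicGeometry.Pohlmann1968.HodgeClassesProductSpanCMProductsSlots
import Literature.AlgebraicGeometry.Motives.AbelianVarietyPoincareCompleteReducibility
import HarnessLib

/-!
# Hodge classes on `X × Y` are exterior products for EVERY splitting of an additive family into two products of
# copies: `Hg(∏_i A_i) = ∏_i Hg(A_i)` ⟹ `HodgeClassesProductSpan (∏_j A_{π₁ j}) (∏_j A_{π₂ j})` for disjoint slot maps

COR-CM (cell `pub-hodgecm2`, binder seat `b16` gen 60, count-neutral claim HODGE GLUING, file G2 — CM fields and their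
realisations; theorems only, no definition, no named fact, no `sorry`).  NEW as stated, hence under `Summits/`.  HONEST
FRAMING: an unconditional structure theorem on Hodge classes of products of CM abelian varieties (Moonen–Zarhin's (3.1)
⟸, fed by rank arithmetic); `HC_CM` is neither used nor asserted, the Hodge conjecture for the two factors is a
HYPOTHESIS of the last theorem.

The tree's product-span theorem `Pohlmann1968.hodgeClassesProductSpan_biproduct_of_typeRank_add` (and its slot form
`…_slots_of_typeRank_add`) is stated for TWO base families indexed by `Fin n`, `Fin m` under the two-block rank
hypothesis `rank(Σ ⊔ Σ') + 1 = cmFamilyRank Φ + cmFamilyRank Φ'`.  Here: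

* §1 `typeRank_sum_add_one_eq_comp` — the two-block hypothesis DESCENDS along arbitrary slot maps `π₁ : J₁ → I₁`,
  `π₂ : J₂ → I₂` of arbitrary finite index types (the tree's `typeRank_sum_add_one_eq_slots` without `Fin`);
  `hodgeClassesProductSpan_biproduct_of_typeRank_add_fintype` — the product-span theorem for base families over arbitrary
  finite index types (reindex along `Fin |I| ≃ I`, `biproduct.reindex`, isogeny invariance of the product-span property);
  `hodgeClassesProductSpan_biproduct_comp_of_typeRank_add` — hence for all products of copies `⨁_j A₁_{π₁ j}`, `⨁_j A₂_{π₂ j}`.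
* §2 ONE family `(K_i; Φ_i)_{i ∈ I}` which is ADDITIVE (`cmFamilyRank Φ + |I| = Σ_i cmTypeRank Φ_i + 1`, i.e.
  `Hg(∏_i A_i) = ∏_i Hg(A_i)`, members ARBITRARY): for slot maps `π₁ : J₁ → I`, `π₂ : J₂ → I` with DISJOINT images,
  **`hodgeClassesProductSpan_biproduct_of_cmFamilyRank_add_card_eq`** — every rational Hodge class on
  `(∏_j A_{π₁ j}) × (∏_j A_{π₂ j})` is a `ℂ`-combination of exterior products of Hodge classes of the two factors — and
  **`hodgeConjectureFor_prod_of_cmFamilyRank_add_card_eq`** — `HC(X) ∧ HC(Y) ⟹ HC(X × Y)` for `X ∼ ∏_j A_{π₁ j}`,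
  `Y ∼ ∏_j A_{π₂ j}`.  (Two-block additivity of `({image π₁}, complement)` is file G1; then §1.)

So every additivity criterion of the tree (pointwise partial conjugations, pairwise `ρ`-separated slots, Galois closures
meeting in totally real fields, the index/degree Helly criteria, reflex pairs …) is at once a GLUING criterion for the
Hodge conjecture with degenerate members allowed; the sequel `IrreducibleOddWeightsHodgeGluing` iterates it.

## References

* [MoonenZarhin1999LowDim] B. Moonen, Yu. Zarhin, *Hodge classes on abelian varieties of low dimension*, Math. Ann.
  315 (1999), §3 (3.1).
* [Gordon1999HodgeAVSurvey] B. B. Gordon, *A survey of the Hodge conjecture for abelian varieties*, §3 Theorem (Imai,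
  Murty) with proof, 7.5–7.7.
* [vanGeemen1994HodgeAV] B. van Geemen, *An introduction to the Hodge conjecture for abelian varieties*, LNM 1594
  (1994), §3.5–3.7.
* [MumfordAV1970] D. Mumford, *Abelian Varieties* (1970), §19.

Provenance: Literature home (namespace `Literature.AlgebraicGeometry.ComplexMultiplication.IrreducibleOddWeightsProductSpan`) of the Summits-side `CorCM/IrreducibleOddWeightsProductSpan` (cell `pub-hodgecm2`, COR-CM; all its imports are `Literature/`, Mathlib and the already re-homed `IrreducibleOddWeightsBlockAdditivity`), which `Literature/` may not import; theorems only, no named fact, no definition. Nothing here bears on `HC_CM`. Lane `lit-hodgefound` (Layer A3: CM types, their Kubota ranks and Galois combinatorics), seat p20.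
-/

set_option autoImplicit false

noncomputable section

open scoped BigOperators

open _root_.CategoryTheory _root_.CategoryTheory.Limits NumberField

namespace Literature.AlgebraicGeometry.ComplexMultiplication.IrreducibleOddWeightsProductSpan

open Literature.AlgebraicGeometry.ComplexMultiplication.BlockAdditivity

open Literature.NumberTheory.ComplexMultiplication
open Literature.AlgebraicGeometry.Motives (AbelianVariety CMType)
open Literature.AlgebraicGeometry.Motives.AbelianVariety
open Literature.AlgebraicGeometry.HodgeTheory
open Literature.AlgebraicGeometry.ComplexMultiplication (IsCMTypeRealisation)
open Literature.AlgebraicGeometry.Pohlmann1968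

/-! ### §1 Two base families over arbitrary finite index types -/

section TwoFamilies

variable {I₁ I₂ J₁ J₂ : Type} [Fintype I₁] [Fintype I₂] [Fintype J₁] [Fintype J₂]
  {K₁ : I₁ → Type} {K₂ : I₂ → Type} [∀ i, Field (K₁ i)] [∀ i, NumberField (K₁ i)] [∀ i, IsCMField (K₁ i)]
  [∀ i, Field (K₂ i)] [∀ i, NumberField (K₂ i)] [∀ i, IsCMField (K₂ i)]

/-- **The two-block rank hypothesis descends along slot maps** (arbitrary finite index types): if
`rank(Σ₁ ⊔ Σ₂) + 1 = cmFamilyRank Φ₁ + cmFamilyRank Φ₂` then the same holds for the slot families `(Φ₁ (π₁ j))_j`,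
`(Φ₂ (π₂ j))_j` of any `π₁ : J₁ → I₁`, `π₂ : J₂ → I₂` (`J₁`, `J₂` non-empty) — `Hg(X^k × Y^l) = Hg(X^k) × Hg(Y^l)` from
`Hg(X × Y) = Hg(X) × Hg(Y)`, along the equivariant slot projections `(j, s) ↦ (π j, s)`.
[cite: MoonenZarhin1999LowDim, §3 (3.1)] -/
theorem typeRank_sum_add_one_eq_comp [Nonempty I₁] [Nonempty I₂] [Nonempty J₁] [Nonempty J₂]
    (Φ₁ : ∀ i, CMType (K₁ i)) (Φ₂ : ∀ i, CMType (K₂ i))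
    (hrank : typeRank (ℂ ≃+* ℂ) {z : (Σ i, (K₁ i →+* ℂ)) ⊕ (Σ i, (K₂ i →+* ℂ)) |
        Sum.elim (· ∈ CMAlgebra.familyType Φ₁) (· ∈ CMAlgebra.familyType Φ₂) z} + 1 =
      CMAlgebra.cmFamilyRank Φ₁ + CMAlgebra.cmFamilyRank Φ₂)
    (π₁ : J₁ → I₁) (π₂ : J₂ → I₂) :
    typeRank (ℂ ≃+* ℂ) {z : (Σ j, (K₁ (π₁ j) →+* ℂ)) ⊕ (Σ j, (K₂ (π₂ j) →+* ℂ)) |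
        Sum.elim (· ∈ CMAlgebra.familyType fun j => Φ₁ (π₁ j)) (· ∈ CMAlgebra.familyType fun j => Φ₂ (π₂ j)) z} + 1 =
      CMAlgebra.cmFamilyRank (fun j => Φ₁ (π₁ j)) + CMAlgebra.cmFamilyRank (fun j => Φ₂ (π₂ j)) := by
  obtain ⟨i₁⟩ := ‹Nonempty I₁›
  obtain ⟨i₂⟩ := ‹Nonempty I₂›
  obtain ⟨j₁⟩ := ‹Nonempty J₁›
  obtain ⟨j₂⟩ := ‹Nonempty J₂›
  haveI : Nonempty (Σ i, (K₁ i →+* ℂ)) := ⟨⟨i₁, Classical.arbitrary _⟩⟩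
  haveI : Nonempty (Σ i, (K₂ i →+* ℂ)) := ⟨⟨i₂, Classical.arbitrary _⟩⟩
  haveI : Nonempty (Σ j, (K₁ (π₁ j) →+* ℂ)) := ⟨⟨j₁, Classical.arbitrary _⟩⟩
  haveI : Nonempty (Σ j, (K₂ (π₂ j) →+* ℂ)) := ⟨⟨j₂, Classical.arbitrary _⟩⟩
  exact typeRank_sum_add_one_eq_of_preimage (CMAlgebra.isCMTypeWith_familyType Φ₁)
    (CMAlgebra.isCMTypeWith_familyType Φ₂) (CMAlgebra.isCMTypeWith_familyType fun j => Φ₁ (π₁ j))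
    (CMAlgebra.isCMTypeWith_familyType fun j => Φ₂ (π₂ j))
    (σ₁ := fun x : (Σ j, (K₁ (π₁ j) →+* ℂ)) => (⟨π₁ x.1, x.2⟩ : Σ i, (K₁ i →+* ℂ)))
    (σ₂ := fun x : (Σ j, (K₂ (π₂ j) →+* ℂ)) => (⟨π₂ x.1, x.2⟩ : Σ i, (K₂ i →+* ℂ)))
    (fun τ z => by obtain ⟨j, s⟩ := z; rfl) (fun τ z => by obtain ⟨j, t⟩ := z; rfl) (fun _ => Iff.rfl)
    (fun _ => Iff.rfl) hrank

variable {Φ₁ : ∀ i, CMType (K₁ i)} {Φ₂ : ∀ i, CMType (K₂ i)}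
  {A₁ : I₁ → AbelianVariety ℂ} {A₂ : I₂ → AbelianVariety ℂ}
  {ι₁ : ∀ i, 𝓞 (K₁ i) →+* End (A₁ i)} {ι₂ : ∀ i, 𝓞 (K₂ i) →+* End (A₂ i)}
  {θ₁ : ∀ i, K₁ i →+* Module.End ℂ (complexBetti (A₁ i).X 1)}
  {θ₂ : ∀ i, K₂ i →+* Module.End ℂ (complexBetti (A₂ i).X 1)}

omit [Fintype J₁] [Fintype J₂] in
/-- **Moonen–Zarhin (3.1) ⟸ for base families over ARBITRARY finite index types**: realisations `(A₁ i ⊨ (K₁ i; Φ₁ i))`,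
`(A₂ i ⊨ (K₂ i; Φ₂ i))` over non-empty finite `I₁`, `I₂` with `rank(Σ₁ ⊔ Σ₂) + 1 = cmFamilyRank Φ₁ + cmFamilyRank Φ₂`
(`Hg(X × Y) = Hg(X) × Hg(Y)`) ⟹ `HodgeClassesProductSpan (⨁ A₁) (⨁ A₂)`.  (Reindex along `Fin |I_r| ≃ I_r`, where the
rank hypothesis descends and the biproducts are isomorphic, `biproduct.reindex`.) [cite: MoonenZarhin1999LowDim, §3 (3.1)]
[cite: Gordon1999HodgeAVSurvey, §3 Theorem (Imai, Murty) with proof] -/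
theorem hodgeClassesProductSpan_biproduct_of_typeRank_add_fintype [Nonempty I₁] [Nonempty I₂]
    (hA₁ : ∀ i, IsCMTypeRealisation (Φ₁ i) (A₁ i) (ι₁ i) (θ₁ i))
    (hA₂ : ∀ i, IsCMTypeRealisation (Φ₂ i) (A₂ i) (ι₂ i) (θ₂ i))
    (hrank : typeRank (ℂ ≃+* ℂ) {z : (Σ i, (K₁ i →+* ℂ)) ⊕ (Σ i, (K₂ i →+* ℂ)) |
        Sum.elim (· ∈ CMAlgebra.familyType Φ₁) (· ∈ CMAlgebra.familyType Φ₂) z} + 1 =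
      CMAlgebra.cmFamilyRank Φ₁ + CMAlgebra.cmFamilyRank Φ₂) :
    HodgeClassesProductSpan (⨁ A₁) (⨁ A₂) := by
  classical
  set e₁ : Fin (Fintype.card I₁) ≃ I₁ := (Fintype.equivFin I₁).symm with he₁
  set e₂ : Fin (Fintype.card I₂) ≃ I₂ := (Fintype.equivFin I₂).symm with he₂
  haveI : NeZero (Fintype.card I₁) := ⟨Fintype.card_ne_zero⟩
  haveI : NeZero (Fintype.card I₂) := ⟨Fintype.card_ne_zero⟩
  have hrank' := typeRank_sum_add_one_eq_comp Φ₁ Φ₂ hrank e₁ e₂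
  have h := hodgeClassesProductSpan_biproduct_of_typeRank_add (K := fun k => K₁ (e₁ k)) (K' := fun k => K₂ (e₂ k))
    (A := fun k => A₁ (e₁ k)) (A' := fun k => A₂ (e₂ k)) (fun k => hA₁ (e₁ k)) (fun k => hA₂ (e₂ k)) hrank'
  have iso₁ : IsIsogenous (⨁ fun k => A₁ (e₁ k)) (⨁ A₁) :=
    ⟨(biproduct.reindex e₁ A₁).hom, isIsogeny_hom_of_iso (biproduct.reindex e₁ A₁)⟩
  have iso₂ : IsIsogenous (⨁ fun k => A₂ (e₂ k)) (⨁ A₂) :=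
    ⟨(biproduct.reindex e₂ A₂).hom, isIsogeny_hom_of_iso (biproduct.reindex e₂ A₂)⟩
  exact h.of_isIsogenous' iso₁ iso₂

/-- **… and for ALL products of copies**: under the same two-block rank hypothesis for `(Φ₁, Φ₂)`,
`HodgeClassesProductSpan (⨁_j A₁ (π₁ j)) (⨁_j A₂ (π₂ j))` for all slot maps `π₁ : J₁ → I₁`, `π₂ : J₂ → I₂` from
non-empty finite `J₁`, `J₂` (the Hodge classes of every `∏ A₁ᵢ^{kᵢ} × ∏ A₂ᵢ^{lᵢ}` are exterior products).
[cite: MoonenZarhin1999LowDim, §3 (3.1)] -/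
theorem hodgeClassesProductSpan_biproduct_comp_of_typeRank_add [Nonempty I₁] [Nonempty I₂] [Nonempty J₁]
    [Nonempty J₂] (hA₁ : ∀ i, IsCMTypeRealisation (Φ₁ i) (A₁ i) (ι₁ i) (θ₁ i))
    (hA₂ : ∀ i, IsCMTypeRealisation (Φ₂ i) (A₂ i) (ι₂ i) (θ₂ i))
    (hrank : typeRank (ℂ ≃+* ℂ) {z : (Σ i, (K₁ i →+* ℂ)) ⊕ (Σ i, (K₂ i →+* ℂ)) |
        Sum.elim (· ∈ CMAlgebra.familyType Φ₁) (· ∈ CMAlgebra.familyType Φ₂) z} + 1 =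
      CMAlgebra.cmFamilyRank Φ₁ + CMAlgebra.cmFamilyRank Φ₂)
    (π₁ : J₁ → I₁) (π₂ : J₂ → I₂) :
    HodgeClassesProductSpan (⨁ fun j => A₁ (π₁ j)) (⨁ fun j => A₂ (π₂ j)) :=
  hodgeClassesProductSpan_biproduct_of_typeRank_add_fintype (K₁ := fun j => K₁ (π₁ j)) (K₂ := fun j => K₂ (π₂ j))
    (fun j => hA₁ (π₁ j)) (fun j => hA₂ (π₂ j)) (typeRank_sum_add_one_eq_comp Φ₁ Φ₂ hrank π₁ π₂)

end TwoFamilies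

/-! ### §2 One additive family, split along disjoint slot maps -/

section OneFamily

variable {I J₁ J₂ : Type} [Fintype I] [Fintype J₁] [Fintype J₂] {K : I → Type} [∀ i, Field (K i)]
  [∀ i, NumberField (K i)] [∀ i, IsCMField (K i)] {Φ : ∀ i, CMType (K i)} {A : I → AbelianVariety ℂ}
  {ιA : ∀ i, 𝓞 (K i) →+* End (A i)} {θ : ∀ i, K i →+* Module.End ℂ (complexBetti (A i).X 1)}

/-- **`Hg(∏_i A_i) = ∏_i Hg(A_i)` ⟹ the Hodge classes of `(∏_j A_{π₁ j}) × (∏_j A_{π₂ j})` are exterior products, for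
DISJOINT slot maps.**  Realisations `A_i ⊨ (K_i; Φ_i)` of an ADDITIVE family of CM types
(`cmFamilyRank Φ + |I| = Σ_i cmTypeRank Φ_i + 1`; the members are arbitrary, degenerate Weil-type factors allowed), and
slot maps `π₁ : J₁ → I`, `π₂ : J₂ → I` from non-empty finite types with `π₁ j₁ ≠ π₂ j₂` always.  THEN
`HodgeClassesProductSpan (⨁_j A (π₁ j)) (⨁_j A (π₂ j))`: every rational Hodge class on the product is a
`ℂ`-combination of exterior products of rational Hodge classes of the two factors.  (G1: the family splits additively along
`{image π₁} ⊔ complement`; §1: the two-block hypothesis descends to the slot families.)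
[cite: MoonenZarhin1999LowDim, §3 (3.1)] [cite: Gordon1999HodgeAVSurvey, §3 Theorem (Imai, Murty) with proof, 7.7] -/
theorem hodgeClassesProductSpan_biproduct_of_cmFamilyRank_add_card_eq [Nonempty J₁] [Nonempty J₂]
    (hadd : CMAlgebra.cmFamilyRank Φ + Fintype.card I = (∑ i, cmTypeRank (Φ i)) + 1)
    (hA : ∀ i, IsCMTypeRealisation (Φ i) (A i) (ιA i) (θ i)) (π₁ : J₁ → I) (π₂ : J₂ → I)
    (hdisj : ∀ j₁ j₂, π₁ j₁ ≠ π₂ j₂) :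
    HodgeClassesProductSpan (⨁ fun j => A (π₁ j)) (⨁ fun j => A (π₂ j)) := by
  classical
  obtain ⟨j₁⟩ := ‹Nonempty J₁›
  obtain ⟨j₂⟩ := ‹Nonempty J₂›
  -- the block of the slots hit by `π₁`, and its complement
  let p : I → Prop := fun i => ∃ j, π₁ j = i
  have hp : ∃ i, p i := ⟨π₁ j₁, j₁, rfl⟩
  have hnp : ∃ i, ¬p i := ⟨π₂ j₂, fun ⟨j, hj⟩ => hdisj j j₂ hj⟩
  haveI : Nonempty {i // p i} := by obtain ⟨i, hi⟩ := hp; exact ⟨⟨i, hi⟩⟩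
  haveI : Nonempty {i // ¬p i} := by obtain ⟨i, hi⟩ := hnp; exact ⟨⟨i, hi⟩⟩
  have hrank := typeRank_sum_add_one_eq_cmFamilyRank_of_add_card_eq Φ p hp hnp hadd
  -- the slot maps factor through the two blocks
  let π₁' : J₁ → {i // p i} := fun j => ⟨π₁ j, j, rfl⟩
  let π₂' : J₂ → {i // ¬p i} := fun j => ⟨π₂ j, fun ⟨j', hj'⟩ => hdisj j' j hj'⟩
  exact hodgeClassesProductSpan_biproduct_comp_of_typeRank_add (K₁ := fun i : {i // p i} => K i.1)
    (K₂ := fun i : {i // ¬p i} => K i.1) (Φ₁ := fun i : {i // p i} => Φ i.1) (Φ₂ := fun i : {i // ¬p i} => Φ i.1)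
    (A₁ := fun i : {i // p i} => A i.1) (A₂ := fun i : {i // ¬p i} => A i.1) (fun i => hA i.1) (fun i => hA i.1)
    hrank π₁' π₂'

/-- **`HC(X) ∧ HC(Y) ⟹ HC(X × Y)` across any disjoint splitting of an additive family**: `X ∼ ∏_j A_{π₁ j}`,
`Y ∼ ∏_j A_{π₂ j}` with `image π₁ ∩ image π₂ = ∅`, the family `(K_i; Φ_i)` additive (`Hg(∏_i A_i) = ∏_i Hg(A_i)`,
members arbitrary).  The Hodge conjecture for `X` and `Y` is the hypothesis (for a degenerate member it may be, e.g.,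
Markman's theorem). [cite: MoonenZarhin1999LowDim, §3 (3.1)] [cite: vanGeemen1994HodgeAV, §3.5–3.7 Lemma 3.7 (p. 236)] -/
theorem hodgeConjectureFor_prod_of_cmFamilyRank_add_card_eq [Nonempty J₁] [Nonempty J₂]
    (hadd : CMAlgebra.cmFamilyRank Φ + Fintype.card I = (∑ i, cmTypeRank (Φ i)) + 1)
    (hA : ∀ i, IsCMTypeRealisation (Φ i) (A i) (ιA i) (θ i)) (π₁ : J₁ → I) (π₂ : J₂ → I)
    (hdisj : ∀ j₁ j₂, π₁ j₁ ≠ π₂ j₂) {X Y : AbelianVariety ℂ} (hXi : IsIsogenous X (⨁ fun j => A (π₁ j)))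
    (hYi : IsIsogenous Y (⨁ fun j => A (π₂ j))) (hHX : HodgeConjectureFor X.dim X.X)
    (hHY : HodgeConjectureFor Y.dim Y.X) : HodgeConjectureFor (X.prod Y).dim (X.prod Y).X :=
  hodgeConjectureFor_prod_of_productSpan X Y
    ((hodgeClassesProductSpan_biproduct_of_cmFamilyRank_add_card_eq hadd hA π₁ π₂ hdisj).of_isIsogenous hXi hYi) hHX hHY

end OneFamily

end Literature.AlgebraicGeometry.ComplexMultiplication.IrreducibleOddWeightsProductSpan

end
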